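import Mathlib
import Summits.Ventures.PercRepro2.RowC1StarForms
import Summits.Ventures.PercRepro2.RowC1OLN
import Summits.Ventures.PercRepro2.RowC1OHN

/-!
# The covariance decomposition of (★): repulsion ≤ type-II mass + attraction
(blind cell PercRepro2, p2 g32; proofs/P2-G32-STAR.md §7)

With `Q = {a₁ ↮ a₂}`, `oL = {o ↔ a₁}`, `oH = {o ↔ a₂}`, `oN = Q ∖ (oL ∪ oH)`, `K_i = C_{G−o}(a_i)`:

  **(★) ⟺ R₂ ≤ II + A₁**, where
  `R₂ = P(Q,oL)·P(Q,oN,b∈K₂) − P(Q,oN)·P(Q,oL,b∈K₂) ≥ 0` (the repulsion, `condK2_oL_le_oN`),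
  `A₁ = P(Q,oN)·P(Q,oH,b∈K₂) − P(Q,oH)·P(Q,oN,b∈K₂) ≥ 0` (the attraction, `condK2_oH_ge_oN`),
  `II = P(Q,oU,b∈K₁)·P(Q)` (the type-II mass).

Both signs are theorems (BHK for the cluster of `a₂` avoiding `{a₁, o}`, resp. of `a₁` avoiding
`{a₂, o}`); what is open is the quantitative bound `R₂ ≤ II + A₁` (`star_iff_repulsion_le`).  Neither
half suffices: `R₂ ≤ II` fails (exact witness in P2-G32-STAR §7) and `R₂ ≤ A₁` fails.
`star_of_repulsion_le_typeII`: `R₂ ≤ II ⟹ (★)` (a valid but not always applicable sufficient condition).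
Std axioms.
-/

namespace Summit.Ventures.PercRepro2

namespace RowC1

section StarDecomp

open Classical

variable {V : Type*} {E : Type*} [Fintype E] [DecidableEq E] [Fintype V] [DecidableEq V]
  {R : Type*} [CommRing R] [LinearOrder R] [IsStrictOrderedRing R]

omit [Fintype E] [DecidableEq E] [Fintype V] [DecidableEq V] in
/-- On `Q`, `o ∈ L` and `o ∈ H` are exclusive. -/
lemma not_oL_oH {ends : E → Sym2 V} {ω : Config E} {a₁ a₂ o : V}
    (h₁ : ω ∈ connEvent ends a₁ o) (h₂ : ω ∈ connEvent ends a₂ o) : ω ∉ (connEvent ends a₁ a₂)ᶜ :=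
  fun hQ => hQ (conn_trans h₁ (conn_symm h₂))

omit [Fintype V] [DecidableEq V] [LinearOrder R] [IsStrictOrderedRing R] in
/-- `P(Q, o ∈ U, A) = P(Q, o ∈ L, A) + P(Q, o ∈ H, A)` for every event `A`. -/
lemma prob_oU_split (p : E → R) (ends : E → Sym2 V) (a₁ a₂ o : V) (A : Set (Config E)) :
    prob p ((connEvent ends a₁ o ∪ connEvent ends a₂ o) ∩ A ∩ (connEvent ends a₁ a₂)ᶜ) =
      prob p (connEvent ends a₁ o ∩ A ∩ (connEvent ends a₁ a₂)ᶜ) +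
        prob p (connEvent ends a₂ o ∩ A ∩ (connEvent ends a₁ a₂)ᶜ) := by
  rw [← prob_union_of_disjoint]
  · congr 1
    ext ω
    simp only [Set.mem_inter_iff, Set.mem_union]
    tauto
  · rw [Set.disjoint_left]
    rintro ω ⟨⟨h₁, _⟩, hQ⟩ ⟨⟨h₂, _⟩, _⟩
    exact not_oL_oH h₁ h₂ hQ

omit [Fintype V] [DecidableEq V] [LinearOrder R] [IsStrictOrderedRing R] in
/-- `P(Q, o ∈ U) = P(Q, o ∈ L) + P(Q, o ∈ H)`. -/
lemma prob_oU_split' (p : E → R) (ends : E → Sym2 V) (a₁ a₂ o : V) :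
    prob p ((connEvent ends a₁ o ∪ connEvent ends a₂ o) ∩ (connEvent ends a₁ a₂)ᶜ) =
      prob p (connEvent ends a₁ o ∩ (connEvent ends a₁ a₂)ᶜ) +
        prob p (connEvent ends a₂ o ∩ (connEvent ends a₁ a₂)ᶜ) := by
  have h := prob_oU_split p ends a₁ a₂ o Set.univ
  simpa only [Set.inter_univ] using h

/-- **(★) ⟺ repulsion ≤ type-II mass + attraction**. -/
theorem star_iff_repulsion_le (p : E → R) (ends : E → Sym2 V) (a₁ a₂ o b : V) :
    StarNonneg p ends a₁ a₂ o b ↔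
    prob p (connEvent ends a₁ o ∩ (connEvent ends a₁ a₂)ᶜ) *
        prob p ((connEvent ends a₁ o ∪ connEvent ends a₂ o)ᶜ ∩ connDelEvent ends {o} b a₂ ∩
          (connEvent ends a₁ a₂)ᶜ) -
      prob p ((connEvent ends a₁ o ∪ connEvent ends a₂ o)ᶜ ∩ (connEvent ends a₁ a₂)ᶜ) *
        prob p (connEvent ends a₁ o ∩ connDelEvent ends {o} b a₂ ∩ (connEvent ends a₁ a₂)ᶜ) ≤
    prob p ((connEvent ends a₁ o ∪ connEvent ends a₂ o) ∩ connDelEvent ends {o} b a₁ ∩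
        (connEvent ends a₁ a₂)ᶜ) * prob p (connEvent ends a₁ a₂)ᶜ +
      (prob p ((connEvent ends a₁ o ∪ connEvent ends a₂ o)ᶜ ∩ (connEvent ends a₁ a₂)ᶜ) *
          prob p (connEvent ends a₂ o ∩ connDelEvent ends {o} b a₂ ∩ (connEvent ends a₁ a₂)ᶜ) -
        prob p (connEvent ends a₂ o ∩ (connEvent ends a₁ a₂)ᶜ) *
          prob p ((connEvent ends a₁ o ∪ connEvent ends a₂ o)ᶜ ∩ connDelEvent ends {o} b a₂ ∩
            (connEvent ends a₁ a₂)ᶜ)) := by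
  rw [starNonneg_iff, prob_oU_split', prob_oU_split p ends a₁ a₂ o (connDelEvent ends {o} b a₂)]
  constructor
  · intro h
    nlinarith [h]
  · intro h
    nlinarith [h]

/-- **The repulsion is nonnegative** (restatement of `condK2_oL_le_oN`). -/
theorem repulsion_nonneg (p : E → R) (hp : IsProbVec p) (ends : E → Sym2 V) (a₁ a₂ o b : V) :
    0 ≤ prob p (connEvent ends a₁ o ∩ (connEvent ends a₁ a₂)ᶜ) *
        prob p ((connEvent ends a₁ o ∪ connEvent ends a₂ o)ᶜ ∩ connDelEvent ends {o} b a₂ ∩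
          (connEvent ends a₁ a₂)ᶜ) -
      prob p ((connEvent ends a₁ o ∪ connEvent ends a₂ o)ᶜ ∩ (connEvent ends a₁ a₂)ᶜ) *
        prob p (connEvent ends a₁ o ∩ connDelEvent ends {o} b a₂ ∩ (connEvent ends a₁ a₂)ᶜ) := by
  have h := condK2_oL_le_oN p hp ends a₁ a₂ o b
  linarith [h]

/-- **The attraction is nonnegative** (restatement of `condK2_oH_ge_oN`). -/
theorem attraction_nonneg (p : E → R) (hp : IsProbVec p) (ends : E → Sym2 V) (a₁ a₂ o b : V) :
    0 ≤ prob p ((connEvent ends a₁ o ∪ connEvent ends a₂ o)ᶜ ∩ (connEvent ends a₁ a₂)ᶜ) *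
          prob p (connEvent ends a₂ o ∩ connDelEvent ends {o} b a₂ ∩ (connEvent ends a₁ a₂)ᶜ) -
        prob p (connEvent ends a₂ o ∩ (connEvent ends a₁ a₂)ᶜ) *
          prob p ((connEvent ends a₁ o ∪ connEvent ends a₂ o)ᶜ ∩ connDelEvent ends {o} b a₂ ∩
            (connEvent ends a₁ a₂)ᶜ) := by
  have h := condK2_oH_ge_oN p hp ends a₁ a₂ o b
  linarith [h]

/-- **(★) from `repulsion ≤ type-II mass`** (a sufficient condition; the attraction is dropped). -/
theorem star_of_repulsion_le_typeII (p : E → R) (hp : IsProbVec p) (ends : E → Sym2 V)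
    (a₁ a₂ o b : V)
    (h : prob p (connEvent ends a₁ o ∩ (connEvent ends a₁ a₂)ᶜ) *
        prob p ((connEvent ends a₁ o ∪ connEvent ends a₂ o)ᶜ ∩ connDelEvent ends {o} b a₂ ∩
          (connEvent ends a₁ a₂)ᶜ) -
      prob p ((connEvent ends a₁ o ∪ connEvent ends a₂ o)ᶜ ∩ (connEvent ends a₁ a₂)ᶜ) *
        prob p (connEvent ends a₁ o ∩ connDelEvent ends {o} b a₂ ∩ (connEvent ends a₁ a₂)ᶜ) ≤
      prob p ((connEvent ends a₁ o ∪ connEvent ends a₂ o) ∩ connDelEvent ends {o} b a₁ ∩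
        (connEvent ends a₁ a₂)ᶜ) * prob p (connEvent ends a₁ a₂)ᶜ) :
    StarNonneg p ends a₁ a₂ o b := by
  rw [star_iff_repulsion_le]
  have hA := attraction_nonneg p hp ends a₁ a₂ o b
  linarith [h, hA]

end StarDecomp

end RowC1

end Summit.Ventures.PercRepro2
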